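import Summits.PneNP.PneNP.Theorems.ChebyshevTracialDesignProjectionDilation
import HarnessLib

/-!
# Cell pnp-psdrank, route `ChebyshevTracialDesign`: PROJECTION NORMAL FORM — in the crux `TracialDecayExp20` (stmt-PneNP-19878) the
# psd rectangles may be taken projection-valued (`X_U² = X_U`, `Y_M² = Y_M`), at the price of tripling the dimension

Brick 35b (prover g9). A tight-orthogonal psd rectangle of dimension `r` (`IsPsdRect X Y`: `0 ⪯ X_U, Y_M ⪯ I_r`, `X_U Y_M = 0` on the tight
pairs) is sent, factor by factor, to the pair of ORTHOGONAL-PROJECTION families `P_U`, `Q_M` of dimension `3r` of brick 35a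
(`…ProjectionDilation`: Halmos dilations of the two sides on different off-diagonal blocks). By `dilationX_proj`, `dilationY_proj`,
`dilation_pair` the new pair is again a tight-orthogonal psd rectangle, consists of projections, and has THE SAME value
`Σ W(U,M) tr(P_U Q_M) = Σ W(U,M) tr(X_U Y_M)` against every weight (`exists_projection_dilation`, §2; the eigenbases come from Mathlib's
spectral theorem, §1). Consequences (§3): any bound proved for projection-valued tight strategies of dimension `3r` holds for all tight
strategies of dimension `r` (`sum_le_of_projections`), in normalised form `TracialValueLEAt W (3γ) r` from the projection-restricted bound `γ`
at dimension `3r` (`tracialValueLEAt_of_projections`). In the language the cell's psd programme uses (p1 N2 §PSD outlook: subspaces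
`A_U ⊥ B_M` on the tight pairs, value `(1/r) Σ W ‖P_{A_U} P_{B_M}‖²_F`), this is the kernel licence for "WLOG subspaces"; the crux-level
equivalence `TracialDecayExp20 ↔ (projection form)` is the leaf brick 35c `…ProjectionCrux` (it must import the route file).
[cite: BrietDadushPokutta2014, Thm. 6 (§3)] [cite: GriblingDelaatLaurent2019, §5] [cite: Rothvoss2017, §2 (PDF pp. 6–7)]
Stature: support/instrument. WHAT THIS IS NOT: no bound on any value, nothing on psd rank of P_PM, no P-vs-NP content.
-/

set_option linter.dupNamespace false -- `Summit.PneNP.PneNP.…`: summit = sub-problem (D-0017)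

noncomputable section

namespace Summit.PneNP.PneNP.Theorems.ChebyshevTracialDesignProjectionNormalForm

open Finset Matrix Literature.Barriers.PneNP Literature.Combinatorics.Optimization
open Summit.PneNP.PneNP.Theorems.ChebyshevTracialDesignCommutative (posSemidef_conj)
open Summit.PneNP.PneNP.Theorems.ChebyshevTracialDesignProjectionDilation

variable {n r : ℕ}

/-! ### §1 Eigen-data of real symmetric contractions -/

/-- **Spectral theorem, packaged**: a real symmetric matrix is `O·diag(x)·Oᵀ` with `OᵀO = I`. -/
theorem exists_eigenbasis {X : Matrix (Fin r) (Fin r) ℝ} (hX : X.IsHermitian) :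
    ∃ (O : Matrix (Fin r) (Fin r) ℝ) (x : Fin r → ℝ), Oᵀ * O = 1 ∧ X = O * diagonal x * Oᵀ := by
  set E : Matrix (Fin r) (Fin r) ℝ := (hX.eigenvectorUnitary : Matrix (Fin r) (Fin r) ℝ) with hE
  have hEs : star E = Eᵀ := by rw [star_eq_conjTranspose, conjTranspose_eq_transpose_of_trivial]
  have hEE : star E * E = 1 := Unitary.coe_star_mul_self hX.eigenvectorUnitary
  have hXd : X = E * diagonal hX.eigenvalues * star E := by
    have h := hX.spectral_theorem
    rw [Unitary.conjStarAlgAut_apply] at h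
    simpa [RCLike.ofReal_real_eq_id] using h
  rw [hEs] at hEE hXd
  exact ⟨E, hX.eigenvalues, hEE, hXd⟩

/-- The eigenvalues of a contraction `0 ⪯ O·diag(x)·Oᵀ ⪯ I` lie in `[0, 1]`. -/
theorem unitInterval_of_conj (O : Matrix (Fin r) (Fin r) ℝ) (hO : Oᵀ * O = 1) (x : Fin r → ℝ) {X : Matrix (Fin r) (Fin r) ℝ}
    (hX : X = O * diagonal x * Oᵀ) (h0 : X.PosSemidef) (h1 : (1 - X).PosSemidef) : ∀ i, 0 ≤ x i ∧ x i ≤ 1 := by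
  have hOXO : Oᵀ * X * (Oᵀ)ᵀ = diagonal x := by
    rw [hX, transpose_transpose]
    calc Oᵀ * (O * diagonal x * Oᵀ) * O = (Oᵀ * O) * diagonal x * (Oᵀ * O) := by simp only [Matrix.mul_assoc]
      _ = diagonal x := by rw [hO, Matrix.one_mul, Matrix.mul_one]
  have hpsd : (diagonal x).PosSemidef := by rw [← hOXO]; exact posSemidef_conj h0 Oᵀ
  have hpsd1 : (diagonal fun i => 1 - x i).PosSemidef := by
    have e : Oᵀ * (1 - X) * (Oᵀ)ᵀ = diagonal fun i => 1 - x i := by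
      rw [Matrix.mul_sub, Matrix.sub_mul, hOXO, transpose_transpose, Matrix.mul_one, hO, ← diagonal_one, diagonal_sub]
    rw [← e]; exact posSemidef_conj h1 Oᵀ
  exact fun i => ⟨posSemidef_diagonal_iff.1 hpsd i, sub_nonneg.1 (posSemidef_diagonal_iff.1 hpsd1 i)⟩

/-! ### §2 Every tight psd rectangle dilates to a tight projection rectangle with the same traces -/

/-- **Projection dilation of a strategy.** For every tight-orthogonal psd rectangle `(X, Y)` of dimension `r` there are families of
`3r × 3r` matrices `P`, `Q` forming a tight-orthogonal psd rectangle of ORTHOGONAL PROJECTIONS (`P_U² = P_U`, `Q_M² = Q_M`) with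
`tr(P_U Q_M) = tr(X_U Y_M)` for every pair `(U, M)`. [cite: BrietDadushPokutta2014, Thm. 6 (§3)] [cite: GriblingDelaatLaurent2019, §5] -/
theorem exists_projection_dilation {X : OddSet n → Matrix (Fin r) (Fin r) ℝ} {Y : PMatch n → Matrix (Fin r) (Fin r) ℝ}
    (hXY : IsPsdRect X Y) :
    ∃ (P : OddSet n → Matrix (Fin (3 * r)) (Fin (3 * r)) ℝ) (Q : PMatch n → Matrix (Fin (3 * r)) (Fin (3 * r)) ℝ),
      IsPsdRect P Q ∧ (∀ U, P U * P U = P U) ∧ (∀ M, Q M * Q M = Q M) ∧ ∀ U M, (P U * Q M).trace = (X U * Y M).trace := by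
  choose O x hO hX using fun U => exists_eigenbasis (hXY.1 U).1.1
  choose O' y hO' hY using fun M => exists_eigenbasis (hXY.2.1 M).1.1
  have hx : ∀ U i, 0 ≤ x U i ∧ x U i ≤ 1 := fun U => unitInterval_of_conj (O U) (hO U) (x U) (hX U) (hXY.1 U).1 (hXY.1 U).2
  have hy : ∀ M i, 0 ≤ y M i ∧ y M i ≤ 1 := fun M =>
    unitInterval_of_conj (O' M) (hO' M) (y M) (hY M) (hXY.2.1 M).1 (hXY.2.1 M).2
  refine ⟨fun U => (Matrix.comp (Fin 3) (Fin 3) (Fin r) (Fin r) ℝ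
      !![X U, O U * diagonal (fun i => Real.sqrt (x U i * (1 - x U i))) * (O U)ᵀ, 0;
         O U * diagonal (fun i => Real.sqrt (x U i * (1 - x U i))) * (O U)ᵀ, 1 - X U, 0; 0, 0, 0]).submatrix
      finProdFinEquiv.symm finProdFinEquiv.symm,
    fun M => (Matrix.comp (Fin 3) (Fin 3) (Fin r) (Fin r) ℝ
      !![Y M, 0, O' M * diagonal (fun i => Real.sqrt (y M i * (1 - y M i))) * (O' M)ᵀ; 0, 0, 0;
         O' M * diagonal (fun i => Real.sqrt (y M i * (1 - y M i))) * (O' M)ᵀ, 0, 1 - Y M]).submatrix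
      finProdFinEquiv.symm finProdFinEquiv.symm, ⟨fun U => ?_, fun M => ?_, fun U M hUM => ?_⟩, fun U => ?_, fun M => ?_,
    fun U M => ?_⟩
  · exact (dilationX_proj (O U) (hO U) (hx U) (hX U) rfl rfl).1
  · exact (dilationY_proj (O' M) (hO' M) (hy M) (hY M) rfl rfl).1
  · exact (dilation_pair (O U) (O' M) (hO U) (hO' M) (hX U) (hY M) rfl rfl rfl rfl).2 (hXY.2.2 U M hUM)
  · exact (dilationX_proj (O U) (hO U) (hx U) (hX U) rfl rfl).2
  · exact (dilationY_proj (O' M) (hO' M) (hy M) (hY M) rfl rfl).2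
  · exact (dilation_pair (O U) (O' M) (hO U) (hO' M) (hX U) (hY M) rfl rfl rfl rfl).1

/-! ### §3 WLOG projections -/

/-- **Bounds transfer from projections.** If `Σ W(U,M) tr(P_U Q_M) ≤ B` for every tight-orthogonal psd rectangle of dimension `3r` made of
orthogonal projections, then `Σ W(U,M) tr(X_U Y_M) ≤ B` for every tight-orthogonal psd rectangle of dimension `r`.
[cite: GriblingDelaatLaurent2019, §5] -/
theorem sum_le_of_projections (W : OddSet n → PMatch n → ℝ) {B : ℝ}
    (h : ∀ (P : OddSet n → Matrix (Fin (3 * r)) (Fin (3 * r)) ℝ) (Q : PMatch n → Matrix (Fin (3 * r)) (Fin (3 * r)) ℝ),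
      IsPsdRect P Q → (∀ U, P U * P U = P U) → (∀ M, Q M * Q M = Q M) → ∑ U, ∑ M, W U M * (P U * Q M).trace ≤ B)
    {X : OddSet n → Matrix (Fin r) (Fin r) ℝ} {Y : PMatch n → Matrix (Fin r) (Fin r) ℝ} (hXY : IsPsdRect X Y) :
    ∑ U, ∑ M, W U M * (X U * Y M).trace ≤ B := by
  obtain ⟨P, Q, hPQ, hP, hQ, htr⟩ := exists_projection_dilation hXY
  have e : ∑ U, ∑ M, W U M * (X U * Y M).trace = ∑ U, ∑ M, W U M * (P U * Q M).trace :=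
    sum_congr rfl fun U _ => sum_congr rfl fun M _ => by rw [htr U M]
  rw [e]; exact h P Q hPQ hP hQ

/-- **WLOG projections, normalised form.** If the normalised value `(Σ W tr(P_U Q_M))/(3r)` is `≤ γ` on every tight-orthogonal psd rectangle of
dimension `3r` made of orthogonal projections, then `TracialValueLEAt W (3γ) r`. [cite: GriblingDelaatLaurent2019, §5] -/
theorem tracialValueLEAt_of_projections (W : OddSet n → PMatch n → ℝ) (γ : ℝ)
    (h : ∀ (P : OddSet n → Matrix (Fin (3 * r)) (Fin (3 * r)) ℝ) (Q : PMatch n → Matrix (Fin (3 * r)) (Fin (3 * r)) ℝ),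
      IsPsdRect P Q → (∀ U, P U * P U = P U) → (∀ M, Q M * Q M = Q M) →
        (∑ U, ∑ M, W U M * (P U * Q M).trace) / ((3 * r : ℕ) : ℝ) ≤ γ) :
    TracialValueLEAt W (3 * γ) r := by
  intro X Y hXY
  obtain ⟨P, Q, hPQ, hP, hQ, htr⟩ := exists_projection_dilation hXY
  have e : ∑ U, ∑ M, W U M * (X U * Y M).trace = ∑ U, ∑ M, W U M * (P U * Q M).trace :=
    sum_congr rfl fun U _ => sum_congr rfl fun M _ => by rw [htr U M]
  have hv := h P Q hPQ hP hQ
  rcases Nat.eq_zero_or_pos r with rfl | hr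
  · simp only [Nat.cast_zero, div_zero, mul_zero] at hv ⊢
    linarith
  · have hr' : (0 : ℝ) < r := by exact_mod_cast hr
    rw [e, div_le_iff₀ hr']
    rw [Nat.cast_mul, Nat.cast_ofNat, div_le_iff₀ (by positivity)] at hv
    linarith

end Summit.PneNP.PneNP.Theorems.ChebyshevTracialDesignProjectionNormalForm

end
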